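import Summits.BirchSwinnertonDyer.BirchSwinnertonDyer.Theorems.SignedLowerHalvesSmallImageLowerHalfBothSignsRttE2KLambdaSocket
import HarnessLib

/-!
# Route `SignedLowerHalves`, crux L `SmallImageLowerHalfBothSigns` (item stmt-BirchSwinnertonDyer-23599), line `rtt_w3` v13 — E2, the (K)-socket ON THE GLUE'S
# CARRIERS: `Λ_𝒪 = IwasawaAlgebraO S` with the glue's `[Algebra Λ Λ_𝒪]`, `algebraMap = iwasawaToIwasawaO S`, `[IsScalarTower Λ Λ_𝒪 ·]` —
# «`(C c)·char_{Λ_𝒪} M = (C d)·char_{Λ_𝒪} N` ⟹ `lambdaInvariant p M = lambdaInvariant p N`» (so road D/T output plugs into `hK` of `charRoad_E2_of_parts`)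

Width seat `bsd-line-slh-p3-w3` g19 under LEAD `cruxlead-stmt-BirchSwinnertonDyer-23599` g9 (cell `bsd-ssimc`); ROUTE-INDEPENDENT helper
(`--supports stmt-BirchSwinnertonDyer-23599`); THEOREMS ONLY — no definition, no named fact, no instance, no `sorry`; closes nothing; BSD is not proved
by any of this. Sequel of `…RttE2KLambdaSocket` (p775583, carrier `PowerSeries (unitBall p E)` with propositional compatibilities).

WHY. HELPER-TABLE v13 addendum 2 (LEAD g9): the glue `charRoad_E2_of_parts` (p775611) binds `H Y` as `Λ_𝒪 = IwasawaAlgebraO S`-modules with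
`[Module Λ ·] [IsScalarTower Λ Λ_𝒪 ·]` for ANY `[Algebra Λ Λ_𝒪]` with `halg : ∀ r, algebraMap Λ Λ_𝒪 r = iwasawaToIwasawaO S r`, and consumes (K) as
`hK : lambdaInvariant p (H ⧸ Submodule.span Λ_𝒪 {z}) ≤ lambdaInvariant p Y`. Road D (p775349 + p775532 + JLK-𝒪 + Rohrlich) and road T produce an
equality of characteristic ideals over `Λ_𝒪` (up to constants). This file states the socket EXACTLY in the glue's instance context (§2), via a
transport-friendly form (§1: any `ι₀ : ℤ_p → 𝒪` pinned in `ℚ̄_p`, the `Λ`-action pinned by `(C r : Λ)•m = (C (ι₀ r) : Λ_𝒪)•m`), reducing to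
p775583 on `unitBall p (padicCoeffField S)` along `padicCoeffIntegers_eq_unitBall` (the `𝒪`- and `ℤ_p`-structures are manufactured by
`Module.compHom` inside the proof — the consumer supplies only the `Λ_𝒪`- and `Λ`-structures it already has).

* §1 `lambdaInvariant_eq_of_span_C_mul_charIdeal_eq_iwasawaAlgebraO` (pinned-`ι₀` form).
* §2 ★★ **`lambdaInvariant_eq_of_span_C_mul_charIdeal_eq_of_algebraMap_eq`** (the glue's context: `[Algebra Λ Λ_𝒪]`, `halg`, `[IsScalarTower Λ Λ_𝒪 ·]`),
  and `lambdaInvariant_le_of_charIdeal_eq_of_algebraMap_eq` (equal char ideals ⟹ the INEQUALITY `hK` the glue consumes).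

References: [Washington1997] §13.2; [BourbakiAC5to7] VII §4.5.
-/

set_option autoImplicit false
-- the Theorems namespace of this sub repeats the summit name by design (D-0017 nested layout)
set_option linter.dupNamespace false

noncomputable section

open Literature.NumberTheory.Automorphic Literature.NumberTheory.EllipticCurves

namespace Summit.BirchSwinnertonDyer.BirchSwinnertonDyer.Theorems.SmallImageRttE2Num

universe v

variable (p : ℕ) [Fact p.Prime] (S : Set (PadicAlgCl p)) [FiniteDimensional ℚ_[p] (padicCoeffField S)]

/-! ## §1. Transport-friendly form: a pinned `ι₀ : ℤ_p → 𝒪` and the `Λ`-action pinned by `(C r)•m = (C (ι₀ r))•m` -/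

/-- **(K)-socket on `IwasawaAlgebraO S`, pinned form.** For ANY ring map `ι₀ : ℤ_p → 𝒪 = padicCoeffIntegers S` compatible with `ℚ̄_p`, f.g. torsion
`Λ_𝒪`-modules `M`, `N` with `Λ = ℤ_p⟦T⟧`-structures satisfying `(C r : Λ)•m = (C (ι₀ r) : Λ_𝒪)•m`, and `c, d ∈ 𝒪 ∖ 0` with
`(C c)·char_{Λ_𝒪} M = (C d)·char_{Λ_𝒪} N`: `lambdaInvariant p M = lambdaInvariant p N`. [cite: Washington1997, §13.2] -/
theorem lambdaInvariant_eq_of_span_C_mul_charIdeal_eq_iwasawaAlgebraO :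
    ∀ (ι₀ : ℤ_[p] →+* padicCoeffIntegers S),
      (∀ x : ℤ_[p], ((ι₀ x : padicCoeffIntegers S) : PadicAlgCl p) = algebraMap ℚ_[p] (PadicAlgCl p) (x : ℚ_[p])) →
    ∀ (M N : Type v) [AddCommGroup M] [AddCommGroup N] [Module (IwasawaAlgebraO S) M] [Module (IwasawaAlgebraO S) N]
      [Module.Finite (IwasawaAlgebraO S) M] [Module.Finite (IwasawaAlgebraO S) N]
      [Module (IwasawaAlgebra p) M] [Module (IwasawaAlgebra p) N],
      Module.IsTorsion (IwasawaAlgebraO S) M → Module.IsTorsion (IwasawaAlgebraO S) N →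
      (∀ (r : ℤ_[p]) (m : M), (PowerSeries.C r : IwasawaAlgebra p) • m = (PowerSeries.C (ι₀ r) : IwasawaAlgebraO S) • m) →
      (∀ (r : ℤ_[p]) (n : N), (PowerSeries.C r : IwasawaAlgebra p) • n = (PowerSeries.C (ι₀ r) : IwasawaAlgebraO S) • n) →
    ∀ (c d : padicCoeffIntegers S), c ≠ 0 → d ≠ 0 →
      Ideal.span {(PowerSeries.C c : IwasawaAlgebraO S)} * Module.charIdeal (IwasawaAlgebraO S) M =
        Ideal.span {(PowerSeries.C d : IwasawaAlgebraO S)} * Module.charIdeal (IwasawaAlgebraO S) N →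
      lambdaInvariant p M = lambdaInvariant p N := by
  unfold IwasawaAlgebraO
  rw [padicCoeffIntegers_eq_unitBall S]
  intro ι₀ hι₀ M N _ _ _ _ _ _ _ _ hM hN hΛM hΛN c d hc hd h
  -- `ι₀` is the structure map
  have hι : ι₀ = algebraMap ℤ_[p] (PadicIntermediateField.unitBall p (padicCoeffField S)) := by
    refine RingHom.ext fun x ↦ Subtype.ext ?_
    rw [hι₀ x]
    change algebraMap ℚ_[p] (PadicAlgCl p) (x : ℚ_[p]) = algebraMap ℤ_[p] (PadicAlgCl p) x
    rw [IsScalarTower.algebraMap_apply ℤ_[p] ℚ_[p] (PadicAlgCl p), PadicInt.algebraMap_apply]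
  subst hι
  -- manufacture the `𝒪`- and `ℤ_p`-structures by restriction along `C` and `C ∘ algebraMap`
  letI mOM : Module (PadicIntermediateField.unitBall p (padicCoeffField S)) M :=
    Module.compHom M (PowerSeries.C : PadicIntermediateField.unitBall p (padicCoeffField S) →+* _)
  letI mON : Module (PadicIntermediateField.unitBall p (padicCoeffField S)) N :=
    Module.compHom N (PowerSeries.C : PadicIntermediateField.unitBall p (padicCoeffField S) →+* _)
  letI mZM : Module ℤ_[p] M := Module.compHom M
    ((PowerSeries.C : PadicIntermediateField.unitBall p (padicCoeffField S) →+* _).comp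
      (algebraMap ℤ_[p] (PadicIntermediateField.unitBall p (padicCoeffField S))))
  letI mZN : Module ℤ_[p] N := Module.compHom N
    ((PowerSeries.C : PadicIntermediateField.unitBall p (padicCoeffField S) →+* _).comp
      (algebraMap ℤ_[p] (PadicIntermediateField.unitBall p (padicCoeffField S))))
  exact lambdaInvariant_eq_of_span_C_mul_charIdeal_eq p (padicCoeffField S) M N hM hN (fun _ _ ↦ rfl) (fun _ _ ↦ rfl)
    (fun _ _ ↦ rfl) (fun _ _ ↦ rfl) (fun r m ↦ hΛM r m) (fun r n ↦ hΛN r n) hc hd h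

/-! ## §2. The glue's context: `[Algebra Λ Λ_𝒪]`, `algebraMap = iwasawaToIwasawaO S`, `[IsScalarTower Λ Λ_𝒪 ·]` -/

/-- ★★ **(K)-socket in the glue's instance context.** With `[Algebra Λ Λ_𝒪]` pinned by `halg : ∀ r, algebraMap Λ Λ_𝒪 r = iwasawaToIwasawaO S r`
(as in `SmallImageRttCharRoad.charRoad_E2_of_parts`) and `M`, `N` f.g. torsion `Λ_𝒪`-modules with `[Module Λ ·] [IsScalarTower Λ Λ_𝒪 ·]`:
`(C c)·char_{Λ_𝒪} M = (C d)·char_{Λ_𝒪} N` (`c, d ≠ 0`) ⟹ `lambdaInvariant p M = lambdaInvariant p N`. [cite: Washington1997, §13.2] -/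
theorem lambdaInvariant_eq_of_span_C_mul_charIdeal_eq_of_algebraMap_eq [Algebra (IwasawaAlgebra p) (IwasawaAlgebraO S)]
    (halg : ∀ r : IwasawaAlgebra p, algebraMap (IwasawaAlgebra p) (IwasawaAlgebraO S) r = iwasawaToIwasawaO S r)
    (M N : Type v) [AddCommGroup M] [AddCommGroup N] [Module (IwasawaAlgebraO S) M] [Module (IwasawaAlgebraO S) N]
    [Module.Finite (IwasawaAlgebraO S) M] [Module.Finite (IwasawaAlgebraO S) N]
    [Module (IwasawaAlgebra p) M] [Module (IwasawaAlgebra p) N]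
    [IsScalarTower (IwasawaAlgebra p) (IwasawaAlgebraO S) M] [IsScalarTower (IwasawaAlgebra p) (IwasawaAlgebraO S) N]
    (hM : Module.IsTorsion (IwasawaAlgebraO S) M) (hN : Module.IsTorsion (IwasawaAlgebraO S) N)
    {c d : padicCoeffIntegers S} (hc : c ≠ 0) (hd : d ≠ 0)
    (h : Ideal.span {(PowerSeries.C c : IwasawaAlgebraO S)} * Module.charIdeal (IwasawaAlgebraO S) M =
      Ideal.span {(PowerSeries.C d : IwasawaAlgebraO S)} * Module.charIdeal (IwasawaAlgebraO S) N) :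
    lambdaInvariant p M = lambdaInvariant p N := by
  have hC : ∀ r : ℤ_[p], algebraMap (IwasawaAlgebra p) (IwasawaAlgebraO S) (PowerSeries.C r) =
      PowerSeries.C (padicIntToCoeffIntegers S r) := fun r ↦ by
    rw [halg]; unfold iwasawaToIwasawaO; rw [PowerSeries.map_C]
  refine lambdaInvariant_eq_of_span_C_mul_charIdeal_eq_iwasawaAlgebraO p S (padicIntToCoeffIntegers S)
    (coe_padicIntToCoeffIntegers S) M N hM hN (fun r m ↦ ?_) (fun r n ↦ ?_) c d hc hd h
  · rw [← IsScalarTower.algebraMap_smul (IwasawaAlgebraO S) (PowerSeries.C r : IwasawaAlgebra p) m, hC]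
  · rw [← IsScalarTower.algebraMap_smul (IwasawaAlgebraO S) (PowerSeries.C r : IwasawaAlgebra p) n, hC]

/-- **Equal characteristic ideals ⟹ the glue's `hK`**: under the hypotheses of `lambdaInvariant_eq_of_span_C_mul_charIdeal_eq_of_algebraMap_eq`,
`char_{Λ_𝒪} M = char_{Λ_𝒪} N` gives `lambdaInvariant p M ≤ lambdaInvariant p N` (and `=`). With `M := H ⧸ Λ_𝒪∙z`, `N := Y` this is the input (K) of
`charRoad_E2_of_parts` from road D's `char(𝐇¹_cyc/∙z_θ) = char(𝐇²_cyc)`. [cite: Washington1997, §13.2] [cite: JohnsonLeungKings2011, Cor. 5.3] -/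
theorem lambdaInvariant_le_of_charIdeal_eq_of_algebraMap_eq [Algebra (IwasawaAlgebra p) (IwasawaAlgebraO S)]
    (halg : ∀ r : IwasawaAlgebra p, algebraMap (IwasawaAlgebra p) (IwasawaAlgebraO S) r = iwasawaToIwasawaO S r)
    (M N : Type v) [AddCommGroup M] [AddCommGroup N] [Module (IwasawaAlgebraO S) M] [Module (IwasawaAlgebraO S) N]
    [Module.Finite (IwasawaAlgebraO S) M] [Module.Finite (IwasawaAlgebraO S) N]
    [Module (IwasawaAlgebra p) M] [Module (IwasawaAlgebra p) N]
    [IsScalarTower (IwasawaAlgebra p) (IwasawaAlgebraO S) M] [IsScalarTower (IwasawaAlgebra p) (IwasawaAlgebraO S) N]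
    (hM : Module.IsTorsion (IwasawaAlgebraO S) M) (hN : Module.IsTorsion (IwasawaAlgebraO S) N)
    (h : Module.charIdeal (IwasawaAlgebraO S) M = Module.charIdeal (IwasawaAlgebraO S) N) :
    lambdaInvariant p M ≤ lambdaInvariant p N :=
  (lambdaInvariant_eq_of_span_C_mul_charIdeal_eq_of_algebraMap_eq p S halg M N hM hN
    (c := 1) (d := 1) one_ne_zero one_ne_zero (by rw [h])).le

end Summit.BirchSwinnertonDyer.BirchSwinnertonDyer.Theorems.SmallImageRttE2Num

end
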